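import Mathlib
import HarnessLib
import Summits.HubbardSuperconductivity.HubbardSuperconductivity.Theorems.KLProgrammeKLRegimeEngineTowerInstRemeasureLev

/-!
# Route `KLProgramme` — crux K3 ENGINE (stmt-HubbardSuperconductivity-20437 `KLRegimeEngineV17F2`), stub (b) v2, THE LEVELS PACKAGE (ℓ), instantiation (I2):
# THE LEVELLED MEASURED PROFILE FROM THE LAW — every track, every degree, EXCEPT the located six-leg cell «(I2)-F1-HMU»
# (memo HOME/prover-p4/F1-HMU-SQUEEZE.md; kit part 9″ `towerBorn_le_law_tracks_of_profile` (…EngineTowerBookkeepingProfile); cell gate-hubbard-kl, seat p4 g18)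

H1 (`klTowerMuLevAt_le_kitSum`, …InstRemeasureLev) bounds the measured size of track `t : Fin 5` (`F = t + 1` known legs) in degree `2p` by a UV term plus the born
blocks at rate `((√2)^d)⁻¹^{(2p+t−6)(k−k′)}` — geometric for EVERY `(t, p)` with `2p + t ≥ 7`, i.e. for every cell except `(t, p) = (0, 3)` (six legs, pin-only level),
where it is flat.  Part 9′ of the kit (`towerBorn_le_law_tracks`) could not read the `t = 0` rows because of its global admissibility `bo + 1 ≤ 3a` (here `bo = 6`); the
profile form 9″ reads the CONSEQUENCE instead.  This file supplies that consequence from H1 and the law on the earlier blocks: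

* §1 `sqrt_two_pow_mul_inv_pow_le_one` — `(√2)^e·(((√2)^d)⁻¹)^e ≤ 1` (`1 ≤ d`); `geom_sum_range_le_inv_one_sub` — `Σ_{j<k} ρ^j ≤ 1/(1−ρ)`;
* §2 **`klTowerMuLevAt_le_profile`** — under H1's binders, a UV law `N₀(t,p)/unit_t(p,0) ≤ A_uv λ^{p−1} Q_uv^p` and the law `klTowerBLev … d t k′ p ≤ A λ^{p−1} Q^p`
  (`1 ≤ k′ ≤ k`, all tracks, all `p ≥ 3`): for every `t : Fin 5`, `p ≥ 3` with `2p + t ≥ 7`,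
  `klTowerMuLevAt … d t k p ≤ A′ λ^{p−1} Q′^p`, `A′ = 27⁵(C₁/C₂)(A_uv + A/(1 − ((√2)^d)⁻¹))`, `Q′ = C₂²·max Q Q_uv`;
* §3 **`klTowerMuLev_le_profile`** — the track-blind array: `klTowerMuLev … d k m ≤ A′ λ^{m−1} Q′^m` for every `m ≥ 4` (this is `hprof` of part 9″ at block `k`), and
  for `m = 3`: `klTowerMuLevAt … d 0 k 3 ≤ X → klTowerMuLev … d k 3 ≤ max X (A′ λ² Q′³)` — the six-leg import `hprof3` MODULO the one located number
  `klTowerMuLevAt … d 0 k 3` (the `F = 1` six-leg measured size), which no landed row bounds k-uniformly (F1-HMU-SQUEEZE §1–§3).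
Compositions of landed theorems and real algebra; nothing about the model is asserted beyond them; nothing asserts (ℓ), any stub, K3 or superconductivity.
References: BGM 2006 §2.8 (2.83), (2.93)–(2.98) [cite: BenfattoGiulianiMastropietro2006].
-/

noncomputable section

namespace Summit.HubbardSuperconductivity.HubbardSuperconductivity.Theorems.EngineV8

set_option linter.dupNamespace false -- summit = problem name (single-conjunct summit), D-0017

open Classical
open Real Finset Literature.MathematicalPhysics.QuantumLattice Literature.Probability.LatticeModels GrassmannAlgebra
open Literature.MathematicalPhysics.QuantumLattice.FermiRG
open Summit.HubbardSuperconductivity.HubbardSuperconductivity.Theorems.KLProgrammeLegKernels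
open Summit.HubbardSuperconductivity.HubbardSuperconductivity.Theorems.KLRegimeSplit
open Summit.HubbardSuperconductivity.HubbardSuperconductivity.Theorems.KLRegimeWick
open Summit.HubbardSuperconductivity.HubbardSuperconductivity.Theorems.TorusFourierL2
open Summit.HubbardSuperconductivity.HubbardSuperconductivity.Theorems.DispersionFlow
open Summit.HubbardSuperconductivity.HubbardSuperconductivity.Theorems.PerturbedFermiCurve

/-! ## §1 Two real-analysis helpers -/

/-- `(√2)^e·(((√2)^d)⁻¹)^e ≤ 1` for `1 ≤ d`. -/
theorem sqrt_two_pow_mul_inv_pow_le_one {d : ℕ} (hd : 1 ≤ d) (e : ℕ) :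
    Real.sqrt 2 ^ e * ((Real.sqrt 2 ^ d)⁻¹) ^ e ≤ 1 := by
  have hs : 1 ≤ Real.sqrt 2 := Real.one_le_sqrt.2 (by norm_num)
  have hs0 : 0 < Real.sqrt 2 := by positivity
  rw [← mul_pow]
  refine pow_le_one₀ (by positivity) ?_
  rw [mul_inv_le_iff₀ (by positivity), one_mul]
  calc Real.sqrt 2 = Real.sqrt 2 ^ 1 := (pow_one _).symm
    _ ≤ Real.sqrt 2 ^ d := pow_le_pow_right₀ hs hd

/-- `Σ_{j < k} ρ^j ≤ 1/(1−ρ)` for `0 ≤ ρ < 1`. -/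
theorem geom_sum_range_le_inv_one_sub {ρ : ℝ} (h0 : 0 ≤ ρ) (h1 : ρ < 1) (k : ℕ) :
    ∑ j ∈ range k, ρ ^ j ≤ 1 / (1 - ρ) := by
  rw [range_eq_Ico]
  have h := geom_sum_Ico_le_of_lt_one h0 h1 (m := 0) (n := k)
  simpa using h

/-! ## §2 The per-track measured profile from the law (every cell except `(t, p) = (0, 3)`) -/

/-- **THE LEVELLED MEASURED PROFILE FROM THE LAW, per track.**  Under the binders of H1 (`klTowerMuLevAt_le_kitSum`: constants `C₁, C₂`, thresholds before the degree),
for `d ≥ 2`, `k ≥ 1`, `dk − 1 ≤ nScales β + 1`, nonnegative `A, λ, Q, A_uv, Q_uv`, level-0 carrier bounds `N₀ t p` with the UV law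
`N₀ t p / klLevUnit … t p 0 ≤ A_uv λ^{p−1} Q_uv^p` (`p ≥ 3`) and the law `klTowerBLev … d t k′ p ≤ A λ^{p−1} Q^p` on the blocks `1 ≤ k′ ≤ k` (all tracks, `p ≥ 3`):
for every track `t : Fin 5` and `p ≥ 3` with `2p + t ≥ 7` — every cell but the six-leg pin-only one —
`klTowerMuLevAt … d t k p ≤ 27⁵(C₁/C₂)(A_uv + A/(1 − ((√2)^d)⁻¹))·λ^{p−1}·(C₂²·max Q Q_uv)^p`. [cite: BenfattoGiulianiMastropietro2006, §2.8 (2.83), (2.93)-(2.98)] -/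
theorem klTowerMuLevAt_le_profile :
    ∃ C₁ C₂ : ℝ, 0 < C₁ ∧ 0 < C₂ ∧ ∀ R : RenConsts, R.WF2 → ∃ c₃' : ℝ, 0 < c₃' ∧ ∃ U₀' : ℝ, 0 < U₀' ∧
      ∀ (P : SplitConsts) (c : ℝ), P.WF → 0 < c → c ≤ klEngC₃6 P R → c ≤ c₃' →
      ∀ μ ∈ klWindowC, ∀ U : ℝ, 0 < U → U ≤ klEngU₀9 P R c → U ≤ U₀' → ∀ β : ℝ, klBetaMin ≤ β → β ≤ Real.exp (c / U ^ 2) →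
      ∀ K : TrigPolyC4v, FrameOK R U (nScales β) μ K → ∀ (L M : ℕ) [NeZero L] [NeZero M],
      klEngL₃ β U ≤ L → klEngM₃ β U L ≤ M → ∀ d k : ℕ, 2 ≤ d → 1 ≤ k → d * k - 1 ≤ nScales β + 1 →
      ∀ (A lam Q Auv Quv : ℝ), 0 ≤ A → 0 ≤ lam → 0 ≤ Q → 0 ≤ Auv → 0 ≤ Quv →
      ∀ N₀ : Fin 5 → ℕ → ℝ, (∀ t p, 0 ≤ N₀ t p) →
        (∀ (t : Fin 5) (p : ℕ) (Ωe' : Fin (2 * p) → Option (SectorLeg (sectorCount 0))), levelCount Ωe' = (t : ℕ) + 1 →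
          klAnisoLegKernelNormAt L M β U μ K klE0 0 (2 * p) Ωe' ≤ N₀ t p) →
        (∀ (t : Fin 5) (p : ℕ), 3 ≤ p → N₀ t p / klLevUnit β M t p 0 ≤ Auv * lam ^ (p - 1) * Quv ^ p) →
        (∀ k' : ℕ, 1 ≤ k' → k' ≤ k → ∀ (t : Fin 5) (p : ℕ), 3 ≤ p → klTowerBLev L M β U μ K d t k' p ≤ A * lam ^ (p - 1) * Q ^ p) →
      ∀ (t : Fin 5) (p : ℕ), 3 ≤ p → 7 ≤ 2 * p + (t : ℕ) →
        klTowerMuLevAt L M β U μ K d t k p ≤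
          (27 : ℝ) ^ 5 * (C₁ / C₂) * (Auv + A / (1 - (Real.sqrt 2 ^ d)⁻¹)) * lam ^ (p - 1) * (C₂ ^ 2 * max Q Quv) ^ p := by
  obtain ⟨C₁, C₂, hC₁, hC₂, h⟩ := klTowerMuLevAt_le_kitSum
  refine ⟨C₁, C₂, hC₁, hC₂, fun R hR2 => ?_⟩
  obtain ⟨c₃, hc₃, U₀, hU₀, h'⟩ := h R hR2
  refine ⟨c₃, hc₃, U₀, hU₀, ?_⟩
  intro P c hP hc hc6 hc₃' μ hμ U hU hU9 hU₀' β hβmin hβc K hK L M _ _ hL3 hM3 d k hd hk1 hkN A lam Q Auv Quv hA hlam hQ hAuv hQuv N₀ hN0 hcar hUV hIH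
    t p hp hpt
  have hβ : 0 < β := KLRegimeSplit.pos_of_klBetaMin_le hβmin
  have ht4 : (t : ℕ) ≤ 4 := by have := t.isLt; omega
  have hs1 : 1 ≤ Real.sqrt 2 := Real.one_le_sqrt.2 (by norm_num)
  have hs0 : 0 < Real.sqrt 2 := by positivity
  -- the rate `ρ = ((√2)^d)⁻¹ ∈ (0, 1)`
  set ρ : ℝ := (Real.sqrt 2 ^ d)⁻¹ with hρ
  have hsd1 : 1 < Real.sqrt 2 ^ d := by
    have h2 : Real.sqrt 2 ^ 2 = 2 := Real.sq_sqrt (by norm_num)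
    calc (1 : ℝ) < 2 := by norm_num
      _ = Real.sqrt 2 ^ 2 := h2.symm
      _ ≤ Real.sqrt 2 ^ d := pow_le_pow_right₀ hs1 hd
  have hρ0 : 0 < ρ := by positivity
  have hρ1 : ρ < 1 := inv_lt_one_of_one_lt₀ hsd1
  have hρle : ρ ≤ 1 := hρ1.le
  have h1ρ : 0 < 1 - ρ := sub_pos.2 hρ1
  -- the exponent `e = 2p + t − 6 ≥ 1`
  set e : ℕ := 2 * p + (t : ℕ) - 6 with he
  have he1 : 1 ≤ e := by omega
  have hmain := h' P c hP hc hc6 hc₃' μ hμ U hU hU9 hU₀' β hβmin hβc K hK L M hL3 hM3 d k hd hk1 hkN t p (by omega) (by omega) (N₀ t p)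
    (hN0 t p) (hcar t p)
  rw [← he] at hmain
  -- laws
  set law : ℕ → ℝ := fun p => A * lam ^ (p - 1) * Q ^ p with hlaw
  have hlaw0 : 0 ≤ law p := by positivity
  have hu0 : 0 < klLevUnit β M t p 0 := klLevUnit_pos hβ t p 0
  -- (i) the UV term
  have hUVt : (Real.sqrt 2 ^ e)⁻¹ ^ (d * k - 1) * (N₀ t p / klLevUnit β M t p 0) ≤ Auv * lam ^ (p - 1) * Quv ^ p := by
    have hb : (Real.sqrt 2 ^ e)⁻¹ ≤ 1 := inv_le_one_of_one_le₀ (one_le_pow₀ hs1)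
    have hb0 : 0 ≤ (Real.sqrt 2 ^ e)⁻¹ := by positivity
    have hpow : (Real.sqrt 2 ^ e)⁻¹ ^ (d * k - 1) ≤ 1 := pow_le_one₀ hb0 hb
    have hq0 : 0 ≤ N₀ t p / klLevUnit β M t p 0 := div_nonneg (hN0 t p) hu0.le
    calc (Real.sqrt 2 ^ e)⁻¹ ^ (d * k - 1) * (N₀ t p / klLevUnit β M t p 0) ≤ 1 * (N₀ t p / klLevUnit β M t p 0) :=
          mul_le_mul_of_nonneg_right hpow hq0
      _ ≤ Auv * lam ^ (p - 1) * Quv ^ p := by rw [one_mul]; exact hUV t p hp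
  -- (ii) the born sum: each term `≤ ρ^{k−k′−1}·law`, the sum `≤ law/(1−ρ)`
  have hterm : ∀ k' ∈ range k, Real.sqrt 2 ^ e * ρ ^ (e * (k - k')) * klTowerBLev L M β U μ K d t (k' + 1) p ≤ ρ ^ (k - 1 - k') * law p := by
    intro k' hk'
    rw [mem_range] at hk'
    obtain ⟨n, hn⟩ : ∃ n, k - k' = n + 1 := ⟨k - k' - 1, by omega⟩
    have hkn : k - 1 - k' = n := by omega
    have hb : klTowerBLev L M β U μ K d t (k' + 1) p ≤ law p := hIH (k' + 1) (by omega) (by omega) t p hp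
    have hb0 : 0 ≤ klTowerBLev L M β U μ K d t (k' + 1) p := klTowerBLev_nonneg hβ U μ K d t (k' + 1) p
    have hrate : Real.sqrt 2 ^ e * ρ ^ (e * (k - k')) ≤ ρ ^ (k - 1 - k') := by
      rw [hn, hkn, show e * (n + 1) = e + e * n by ring, pow_add, ← mul_assoc]
      have h1 : Real.sqrt 2 ^ e * ρ ^ e ≤ 1 := sqrt_two_pow_mul_inv_pow_le_one (by omega) e
      have h2 : ρ ^ (e * n) ≤ ρ ^ n := by
        rw [mul_comm, pow_mul]
        exact pow_le_of_le_one (by positivity) (pow_le_one₀ hρ0.le hρle) (by omega)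
      calc Real.sqrt 2 ^ e * ρ ^ e * ρ ^ (e * n) ≤ 1 * ρ ^ n := mul_le_mul h1 h2 (by positivity) zero_le_one
        _ = ρ ^ n := one_mul _
    calc Real.sqrt 2 ^ e * ρ ^ (e * (k - k')) * klTowerBLev L M β U μ K d t (k' + 1) p
        ≤ ρ ^ (k - 1 - k') * klTowerBLev L M β U μ K d t (k' + 1) p := mul_le_mul_of_nonneg_right hrate hb0
      _ ≤ ρ ^ (k - 1 - k') * law p := mul_le_mul_of_nonneg_left hb (by positivity)
  have hsum : ∑ k' ∈ range k, Real.sqrt 2 ^ e * ρ ^ (e * (k - k')) * klTowerBLev L M β U μ K d t (k' + 1) p ≤ law p / (1 - ρ) := by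
    refine (sum_le_sum hterm).trans ?_
    rw [← sum_mul, sum_range_reflect (fun j => ρ ^ j) k]
    calc (∑ j ∈ range k, ρ ^ j) * law p ≤ 1 / (1 - ρ) * law p :=
          mul_le_mul_of_nonneg_right (geom_sum_range_le_inv_one_sub hρ0.le hρ1 k) hlaw0
      _ = law p / (1 - ρ) := by rw [one_div, inv_mul_eq_div]
  -- (iii) assemble
  have hpre0 : 0 ≤ (27 : ℝ) ^ ((t : ℕ) + 1) * (C₁ * C₂ ^ (2 * p - 1)) := by positivity
  have h27 : (27 : ℝ) ^ ((t : ℕ) + 1) ≤ 27 ^ 5 := pow_le_pow_right₀ (by norm_num) (by omega)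
  set Mq := max Q Quv with hMq
  have hQM : Q ≤ Mq := le_max_left _ _
  have hQuvM : Quv ≤ Mq := le_max_right _ _
  have hMq0 : 0 ≤ Mq := hQ.trans hQM
  have hin : Auv * lam ^ (p - 1) * Quv ^ p + law p / (1 - ρ) ≤ (Auv + A / (1 - ρ)) * lam ^ (p - 1) * Mq ^ p := by
    have h1 : Auv * lam ^ (p - 1) * Quv ^ p ≤ Auv * lam ^ (p - 1) * Mq ^ p :=
      mul_le_mul_of_nonneg_left (pow_le_pow_left₀ hQuv hQuvM p) (by positivity)
    have h2 : law p / (1 - ρ) ≤ A / (1 - ρ) * lam ^ (p - 1) * Mq ^ p := by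
      rw [hlaw]; dsimp only
      rw [div_eq_mul_inv, show A / (1 - ρ) * lam ^ (p - 1) * Mq ^ p = A * lam ^ (p - 1) * Mq ^ p * (1 - ρ)⁻¹ by ring]
      exact mul_le_mul_of_nonneg_right (mul_le_mul_of_nonneg_left (pow_le_pow_left₀ hQ hQM p) (by positivity))
        (inv_nonneg.2 h1ρ.le)
    calc Auv * lam ^ (p - 1) * Quv ^ p + law p / (1 - ρ) ≤ Auv * lam ^ (p - 1) * Mq ^ p + A / (1 - ρ) * lam ^ (p - 1) * Mq ^ p :=
          add_le_add h1 h2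
      _ = (Auv + A / (1 - ρ)) * lam ^ (p - 1) * Mq ^ p := by ring
  have hin0 : 0 ≤ (Auv + A / (1 - ρ)) * lam ^ (p - 1) * Mq ^ p := by
    have : 0 ≤ A / (1 - ρ) := div_nonneg hA h1ρ.le
    positivity
  have hC : C₁ * C₂ ^ (2 * p - 1) = C₁ / C₂ * (C₂ ^ 2) ^ p := by
    have hpw : (C₂ ^ 2) ^ p = C₂ ^ (2 * p - 1) * C₂ := by
      rw [← pow_mul, ← pow_succ]; congr 1; omega
    rw [hpw]
    field_simp
  calc klTowerMuLevAt L M β U μ K d t k p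
      ≤ (27 : ℝ) ^ ((t : ℕ) + 1) * (C₁ * C₂ ^ (2 * p - 1)) *
          ((Real.sqrt 2 ^ e)⁻¹ ^ (d * k - 1) * (N₀ t p / klLevUnit β M t p 0) +
            ∑ k' ∈ range k, Real.sqrt 2 ^ e * ρ ^ (e * (k - k')) * klTowerBLev L M β U μ K d t (k' + 1) p) := hmain
    _ ≤ (27 : ℝ) ^ ((t : ℕ) + 1) * (C₁ * C₂ ^ (2 * p - 1)) * (Auv * lam ^ (p - 1) * Quv ^ p + law p / (1 - ρ)) :=
        mul_le_mul_of_nonneg_left (add_le_add hUVt hsum) hpre0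
    _ ≤ (27 : ℝ) ^ 5 * (C₁ * C₂ ^ (2 * p - 1)) * ((Auv + A / (1 - ρ)) * lam ^ (p - 1) * Mq ^ p) := by
        have : (27 : ℝ) ^ ((t : ℕ) + 1) * (C₁ * C₂ ^ (2 * p - 1)) ≤ 27 ^ 5 * (C₁ * C₂ ^ (2 * p - 1)) :=
          mul_le_mul_of_nonneg_right h27 (by positivity)
        have hsum0 : 0 ≤ Auv * lam ^ (p - 1) * Quv ^ p + law p / (1 - ρ) := add_nonneg (by positivity) (div_nonneg hlaw0 h1ρ.le)
        exact mul_le_mul this hin hsum0 (by positivity)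
    _ = (27 : ℝ) ^ 5 * (C₁ / C₂) * (Auv + A / (1 - ρ)) * lam ^ (p - 1) * (C₂ ^ 2 * Mq) ^ p := by rw [hC, mul_pow]; ring

/-! ## §3 The track-blind profile: `hprof` (degrees ≥ 8) and `hprof3` modulo the located six-leg cell -/

/-- **THE TRACK-BLIND MEASURED PROFILE** (the `hprof`/`hprof3` inputs of `towerBorn_le_law_tracks_of_profile` for the levelled model at block `k`): under the
binders of `klTowerMuLevAt_le_profile`, (a) for every `m ≥ 4`: `klTowerMuLev … d k m ≤ A′ λ^{m−1} Q′^m`; (b) for `m = 3`, GIVEN any bound `X` on the located cell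
`klTowerMuLevAt … d 0 k 3` (six legs, pin-only level — «(I2)-F1-HMU»): `klTowerMuLev … d k 3 ≤ max X (A′ λ² Q′³)`; with
`A′ = 27⁵(C₁/C₂)(A_uv + A/(1 − ((√2)^d)⁻¹))`, `Q′ = C₂²·max Q Q_uv`. [cite: BenfattoGiulianiMastropietro2006, §2.8 (2.83), (2.93)-(2.98)] -/
theorem klTowerMuLev_le_profile :
    ∃ C₁ C₂ : ℝ, 0 < C₁ ∧ 0 < C₂ ∧ ∀ R : RenConsts, R.WF2 → ∃ c₃' : ℝ, 0 < c₃' ∧ ∃ U₀' : ℝ, 0 < U₀' ∧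
      ∀ (P : SplitConsts) (c : ℝ), P.WF → 0 < c → c ≤ klEngC₃6 P R → c ≤ c₃' →
      ∀ μ ∈ klWindowC, ∀ U : ℝ, 0 < U → U ≤ klEngU₀9 P R c → U ≤ U₀' → ∀ β : ℝ, klBetaMin ≤ β → β ≤ Real.exp (c / U ^ 2) →
      ∀ K : TrigPolyC4v, FrameOK R U (nScales β) μ K → ∀ (L M : ℕ) [NeZero L] [NeZero M],
      klEngL₃ β U ≤ L → klEngM₃ β U L ≤ M → ∀ d k : ℕ, 2 ≤ d → 1 ≤ k → d * k - 1 ≤ nScales β + 1 →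
      ∀ (A lam Q Auv Quv : ℝ), 0 ≤ A → 0 ≤ lam → 0 ≤ Q → 0 ≤ Auv → 0 ≤ Quv →
      ∀ N₀ : Fin 5 → ℕ → ℝ, (∀ t p, 0 ≤ N₀ t p) →
        (∀ (t : Fin 5) (p : ℕ) (Ωe' : Fin (2 * p) → Option (SectorLeg (sectorCount 0))), levelCount Ωe' = (t : ℕ) + 1 →
          klAnisoLegKernelNormAt L M β U μ K klE0 0 (2 * p) Ωe' ≤ N₀ t p) →
        (∀ (t : Fin 5) (p : ℕ), 3 ≤ p → N₀ t p / klLevUnit β M t p 0 ≤ Auv * lam ^ (p - 1) * Quv ^ p) →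
        (∀ k' : ℕ, 1 ≤ k' → k' ≤ k → ∀ (t : Fin 5) (p : ℕ), 3 ≤ p → klTowerBLev L M β U μ K d t k' p ≤ A * lam ^ (p - 1) * Q ^ p) →
      (∀ m : ℕ, 4 ≤ m →
        klTowerMuLev L M β U μ K d k m ≤
          (27 : ℝ) ^ 5 * (C₁ / C₂) * (Auv + A / (1 - (Real.sqrt 2 ^ d)⁻¹)) * lam ^ (m - 1) * (C₂ ^ 2 * max Q Quv) ^ m) ∧
      (∀ X : ℝ, klTowerMuLevAt L M β U μ K d 0 k 3 ≤ X →
        klTowerMuLev L M β U μ K d k 3 ≤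
          max X ((27 : ℝ) ^ 5 * (C₁ / C₂) * (Auv + A / (1 - (Real.sqrt 2 ^ d)⁻¹)) * lam ^ 2 * (C₂ ^ 2 * max Q Quv) ^ 3)) := by
  obtain ⟨C₁, C₂, hC₁, hC₂, h⟩ := klTowerMuLevAt_le_profile
  refine ⟨C₁, C₂, hC₁, hC₂, fun R hR2 => ?_⟩
  obtain ⟨c₃, hc₃, U₀, hU₀, h'⟩ := h R hR2
  refine ⟨c₃, hc₃, U₀, hU₀, ?_⟩
  intro P c hP hc hc6 hc₃' μ hμ U hU hU9 hU₀' β hβmin hβc K hK L M _ _ hL3 hM3 d k hd hk1 hkN A lam Q Auv Quv hA hlam hQ hAuv hQuv N₀ hN0 hcar hUV hIH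
  have hcell := h' P c hP hc hc6 hc₃' μ hμ U hU hU9 hU₀' β hβmin hβc K hK L M hL3 hM3 d k hd hk1 hkN A lam Q Auv Quv hA hlam hQ hAuv hQuv N₀ hN0 hcar hUV hIH
  refine ⟨fun m hm => ?_, fun X hX => ?_⟩
  · obtain ⟨t, ht⟩ := exists_klTowerMuLev_eq (L := L) (M := M) β U μ K d k m
    rw [ht]
    exact hcell t m (by omega) (by omega)
  · obtain ⟨t, ht⟩ := exists_klTowerMuLev_eq (L := L) (M := M) β U μ K d k 3
    rw [ht]
    by_cases ht0 : (t : ℕ) = 0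
    · have : t = 0 := Fin.ext ht0
      rw [this]
      exact hX.trans (le_max_left _ _)
    · have h7 : 7 ≤ 2 * 3 + (t : ℕ) := by omega
      have := hcell t 3 le_rfl h7
      exact this.trans (le_max_right _ _)

end Summit.HubbardSuperconductivity.HubbardSuperconductivity.Theorems.EngineV8

end
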